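import Mathlib
import Summits.Ventures.HodgeRepro.Tier4.Line1.RTFSetting
import Summits.Ventures.HodgeRepro.Tier4.Line1.LeftTypeOfMatrixCoeff
import Summits.Ventures.HodgeRepro.Tier4.Line1.FiniteRankTypeApprox

/-!
# Tier4/Line1/FiniteRankTypeApproxFibre — the Stone–Weierstrass approximant FACTORS THROUGH THE COORDINATES
(the density theorem of FiniteRankTypeApprox with the fibre clause of the approximant exposed)

Blind re-derivation cell `pub-hodge-repro`, Tier 4 (README §9–§10), seat t4-L1-p4 (gen 4), LINE L1; generic over a
topological group `G`.  Target tree path `lean/Summits/Ventures/HodgeRepro/Tier4/Line1/FiniteRankTypeApproxFibre.lean`.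
Imports this seat's FiniteRankTypeApprox (the closure lemmas) and p2's LeftTypeOfMatrixCoeff.  0 print.

WHAT IS PROVED.  **`exists_finiteRankLeftType_approx_fibre`** = `exists_finiteRankLeftType_approx` (same hypotheses,
same proof) with ONE more conclusion: the approximant `h` is constant on the fibres of the coordinate map
`g ↦ (u i g)_i` over `X` — it is `P ∘ Φ` on `X` for a polynomial `P` in the coordinates and their conjugates, and `0`
off `X`.  This is what the bi-invariant form of the (S1b) bridge needs (t4-plan-1 S14297, cut (a)): on the instance the
coordinates are chosen bi-invariant under the level `K(N)` (double-coset indicators and archimedean entries), so the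
approximant inherits the bi-`K(N)`-invariance of `f₀` WITHOUT any averaging of `h`.  The proof is that of
FiniteRankTypeApprox (landed p689232) repeated verbatim — append-only discipline keeps the landed file as it is — plus
three lines for the fibre clause.  Nothing here says anything about the status of the Hodge conjecture for CM abelian
varieties, which is NOT proved (HC_CM is NOT proved by anyone in this repository).
-/

set_option autoImplicit false

noncomputable section

namespace Summit.Ventures.HodgeRepro.Tier4.Line1.RTF

open Topology

variable {G : Type} [Group G] [TopologicalSpace G] [T2Space G] {K : Subgroup G}

/-- **the density theorem with the fibre clause**: as `exists_finiteRankLeftType_approx`, and the approximant `h` is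
constant on the fibres of `g ↦ (u i g)_i` over `X`. -/
theorem exists_finiteRankLeftType_approx_fibre {X : Set G} (hXc : IsCompact X) (hXo : IsOpen X)
    (hX1 : HasFiniteRankLeftType K (X.indicator fun _ => (1 : ℂ)))
    {ι : Type} [Fintype ι] (u : ι → G → ℂ) (hu : ∀ i, Continuous (u i))
    (hut : ∀ i, HasFiniteRankLeftType K (X.indicator (u i)))
    {f₀ : G → ℂ} (h₀ : Continuous f₀) (hf₀ : ∀ g, g ∉ X → f₀ g = 0)
    (hfib : ∀ x ∈ X, ∀ y ∈ X, (∀ i, u i x = u i y) → f₀ x = f₀ y) {η : ℝ} (hη : 0 < η) :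
    ∃ h : G → ℂ, IsTest h ∧ (∀ g, g ∉ X → h g = 0) ∧ HasFiniteRankLeftType K h ∧
      (∀ x ∈ X, ∀ y ∈ X, (∀ i, u i x = u i y) → h x = h y) ∧ ∀ g, ‖h g - f₀ g‖ ≤ η := by
  classical
  have hXcl : IsClosed X := hXc.isClosed
  -- the coordinate map and its compact image
  let Φ : G → (ι → ℂ) := fun g i => u i g
  have hΦ : Continuous Φ := continuous_pi hu
  let Y : Set (ι → ℂ) := Φ '' X
  haveI : CompactSpace Y := isCompact_iff_compactSpace.mp (hXc.image hΦ)
  haveI : CompactSpace X := isCompact_iff_compactSpace.mp hXc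
  let q : X → Y := fun x => ⟨Φ x, ⟨x, x.2, rfl⟩⟩
  have hq : Continuous q := (hΦ.comp continuous_subtype_val).subtype_mk _
  have hqs : Function.Surjective q := by
    rintro ⟨y, x, hx, rfl⟩
    exact ⟨⟨x, hx⟩, rfl⟩
  have hqq : IsQuotientMap q := hq.isClosedMap.isQuotientMap hq hqs
  -- `f₀` descends to `Y`
  let F : Y → ℂ := fun y => f₀ (Classical.choose y.2)
  have hF : ∀ x (hx : x ∈ X), F ⟨Φ x, ⟨x, hx, rfl⟩⟩ = f₀ x := by
    intro x hx
    obtain ⟨hx', hΦx⟩ := Classical.choose_spec (⟨x, hx, rfl⟩ : ∃ x', x' ∈ X ∧ Φ x' = Φ x)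
    exact hfib _ hx' x hx fun i => congrFun hΦx i
  have hFc : Continuous F := by
    rw [hqq.continuous_iff]
    have : F ∘ q = fun x : X => f₀ x := by
      funext x
      exact hF x x.2
    rw [this]
    exact h₀.comp continuous_subtype_val
  let Fc : C(Y, ℂ) := ⟨F, hFc⟩
  -- the coordinate functions generate a point-separating star-subalgebra of `C(Y, ℂ)`
  let coord : ι → C(Y, ℂ) := fun i => ⟨fun y => y.1 i, (continuous_apply i).comp continuous_subtype_val⟩
  let A : StarSubalgebra ℂ C(Y, ℂ) := StarAlgebra.adjoin ℂ (Set.range coord)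
  have hsep : A.SeparatesPoints := by
    intro y y' hne
    have : ∃ i, y.1 i ≠ y'.1 i := by
      by_contra hcon
      apply hne
      apply Subtype.ext
      funext i
      by_contra hi
      exact hcon ⟨i, hi⟩
    obtain ⟨i, hi⟩ := this
    exact ⟨coord i, ⟨coord i, StarAlgebra.subset_adjoin ℂ _ ⟨i, rfl⟩, rfl⟩, hi⟩
  have hdense : A.topologicalClosure = ⊤ :=
    ContinuousMap.starSubalgebra_topologicalClosure_eq_top_of_separatesPoints A hsep
  have hmem : Fc ∈ closure (A : Set C(Y, ℂ)) := by
    rw [← StarSubalgebra.topologicalClosure_coe, hdense]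
    exact Set.mem_univ _
  obtain ⟨P, hPA, hPd⟩ := Metric.mem_closure_iff.1 hmem η hη
  -- the lift of a function on `Y` to `G`, by `0` off `X`
  let L : C(Y, ℂ) → G → ℂ := fun Q g => if hg : g ∈ X then Q ⟨Φ g, ⟨g, hg, rfl⟩⟩ else 0
  have hL0 : ∀ Q g, g ∉ X → L Q g = 0 := fun Q g hg => dif_neg hg
  have hLmem : ∀ Q g (hg : g ∈ X), L Q g = Q ⟨Φ g, ⟨g, hg, rfl⟩⟩ := fun Q g hg => dif_pos hg
  have hLc : ∀ Q : C(Y, ℂ), Continuous (L Q) := by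
    intro Q
    rw [continuous_iff_continuousAt]
    intro g
    by_cases hg : g ∈ X
    · have hcont : ContinuousOn (L Q) X := by
        rw [continuousOn_iff_continuous_restrict]
        have : X.restrict (L Q) = fun x : X => Q (q x) := by
          funext x
          exact hLmem Q x x.2
        rw [this]
        exact Q.continuous.comp hq
      exact hcont.continuousAt (hXo.mem_nhds hg)
    · have hcont : ContinuousOn (L Q) Xᶜ :=
        (continuousOn_const (c := (0 : ℂ))).congr fun x hx => hL0 Q x hx
      exact hcont.continuousAt (hXcl.isOpen_compl.mem_nhds hg)
  have hLt : ∀ Q, IsTest (L Q) := fun Q =>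
    ⟨hLc Q, HasCompactSupport.intro' hXc hXcl fun g hg => hL0 Q g hg⟩
  have hLadd : ∀ Q Q', L (Q + Q') = fun g => L Q g + L Q' g := by
    intro Q Q'
    funext g
    by_cases hg : g ∈ X
    · simp only [L, dif_pos hg, ContinuousMap.add_apply]
    · simp only [L, dif_neg hg, add_zero]
  have hLmul : ∀ Q Q', L (Q * Q') = fun g => L Q g * L Q' g := by
    intro Q Q'
    funext g
    by_cases hg : g ∈ X
    · simp only [L, dif_pos hg, ContinuousMap.mul_apply]
    · simp only [L, dif_neg hg, mul_zero]
  have hLstar : ∀ Q, L (star Q) = fun g => starRingEnd ℂ (L Q g) := by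
    intro Q
    funext g
    by_cases hg : g ∈ X
    · simp only [L, dif_pos hg, ContinuousMap.star_apply, Complex.star_def]
    · simp only [L, dif_neg hg, map_zero]
  have hLalg : ∀ r : ℂ, L (algebraMap ℂ C(Y, ℂ) r) = fun g => r * X.indicator (fun _ => (1 : ℂ)) g := by
    intro r
    funext g
    by_cases hg : g ∈ X
    · simp only [L, dif_pos hg, Set.indicator_of_mem hg, mul_one, Algebra.algebraMap_eq_smul_one,
        ContinuousMap.smul_apply, ContinuousMap.one_apply, smul_eq_mul]
    · simp only [L, dif_neg hg, Set.indicator_of_notMem hg, mul_zero]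
  have hLcoord : ∀ i, L (coord i) = X.indicator (u i) := by
    intro i
    funext g
    by_cases hg : g ∈ X
    · simp only [L, dif_pos hg, Set.indicator_of_mem hg, coord, ContinuousMap.coe_mk, Φ]
    · simp only [L, dif_neg hg, Set.indicator_of_notMem hg]
  -- every element of the star-subalgebra lifts to a finite-rank left-`K`-type
  have hA : ∀ Q ∈ A, HasFiniteRankLeftType K (L Q) := by
    intro Q hQ
    refine StarAlgebra.adjoin_induction (p := fun Q _ => HasFiniteRankLeftType K (L Q)) ?_ ?_ ?_ ?_ ?_ hQ
    · rintro x ⟨i, rfl⟩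
      rw [hLcoord]
      exact hut i
    · intro r
      rw [hLalg]
      exact hX1.const_mul r
    · intro x y _ _ hx hy
      rw [hLadd]
      exact hx.add hy
    · intro x y _ _ hx hy
      rw [hLmul]
      exact hx.mul hy
    · intro x _ hx
      rw [hLstar]
      exact hx.star
  -- the approximant
  refine ⟨L P, hLt P, hL0 P, hA P hPA, ?_, fun g => ?_⟩
  · intro x hx y hy hxy
    rw [hLmem P x hx, hLmem P y hy]
    congr 1
    exact Subtype.ext (funext hxy)
  by_cases hg : g ∈ X
  · rw [hLmem P g hg, ← hF g hg]
    have h1 : dist (P ⟨Φ g, ⟨g, hg, rfl⟩⟩) (Fc ⟨Φ g, ⟨g, hg, rfl⟩⟩) ≤ dist P Fc :=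
      ContinuousMap.dist_apply_le_dist _
    rw [dist_eq_norm] at h1
    have h2 : dist P Fc < η := by
      rw [dist_comm]
      exact hPd
    exact h1.trans h2.le
  · rw [hL0 P g hg, hf₀ g hg, sub_zero, norm_zero]
    exact hη.le

end Summit.Ventures.HodgeRepro.Tier4.Line1.RTF

end
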